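import Summits.QuantumFields.YangMills.Theorems.BalabanUVNodesN14LawChannelPushForwardPath
import Summits.QuantumFields.YangMills.Theorems.BalabanUVNodesN19TiltPathRoad

/-!
# BalabanUVNodes ∕ N14 — THE LAW CHANNEL MEETS ROAD III: a FINE-space tilt path with fine DRIFT and CONDITIONED OSCILLATION produces, on the
# class pieces seen as IMAGE LAWS, MASS_cl, TV_cl, the observable-uniform `Spine.NE7.Core` and N14's binder `TiltedMeanMatching` BY NAME

Cell `pub-ymgap` (HUMAN RULING D-0062, Track A), node N14 = NE1′, seat `pub-ymgap-dag-n14-c` (R134 ACCELERATION, s1), generation 8; cluster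
K3⁶ `SpineGivenEndpointR13SepCoPR` (stmt-QuantumFields-20509; `--kind proof --supports … --as helper`, dag-lead WORDS-142).  ADDITIVE — imports the one-piece module
`Thm/BalabanUVNodesN14LawChannelPushForwardPath` (hence the dictionary `…N14LawChannelPushForward`) and dag-n19-c's road III
`Thm/BalabanUVNodesN19TiltPathRoad` (p509274: `massSandwich_of_tiltPath`, `tvSandwich_of_tiltPath`, `core_of_tiltPath`, `tiltedMeanMatching_of_tiltPath`,
CITED) ONLY; 0 `def`; edits nothing.  COUNT-NEUTRAL.  Third of four modules (the fourth, `…PushForwardToy`, inhabits `tvSandwich_of_finePath`).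

THE SENTENCE TYPED (LENS control memo v6.2 §D (D2), `Sketch-control-g9.lean` 27be075ad5a82fec): «a fine-space (tuned) path enters III through its
PUSH-FORWARD along the class map `q` — exponent the fibre log-MGF `Λ`, direction the CONDITIONED direction `h`; DRIFT is INVARIANT, OSC
CONTRACTS; III's letters on `(Λ, h)` = the lens's (F2″) letters».  SETTING.  Per cutoff a FINE space `Φ K` (standard Borel), a CLASS space
`Ω K`, a measurable class map `q K : Φ K → Ω K` (at the record: the unit-lattice field read off the fine field); two runs' FINE class pieces
`νA K τ` (finite at EVERY index — a consumer sets the pieces outside `T K` to `0`), `νB K τ` joined class by class by a fine tilt path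
`νB K τ = e^{Ψ K τ 1}·νA K τ`, `Ψ K τ 0 = 0` (road III's regularity letters, on the fine space); the CLASS pieces are the IMAGE LAWS `(νX K τ).map (q K)`; the dressed class terms are in MGF form for a `B`-bounded
CLASS-space (= fibre-blind, lens (OBS)) observable family `W K` — `mgfForm_map_of_comp`: MGF form on the fine pieces for `W K ∘ q K` IS MGF form
on the image pieces for `W K`.
* §3 THE JUNCTION (kernel letters; `classPath_letters` bundles module 2's per-piece lemmas): ★ `massSandwich_of_finePath` (fine DRIFT ⇒ MASS_cl on
  the image pieces), ★ `tvSandwich_of_finePath` (CONDITIONED OSC `∫ |h_u(qU) − ∫Ψ′_u dν̂_u| dν̂_u(U) ≤ 2ρ K` ⇒ TV_cl), ★★ `core_of_finePath` (both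
  + III's width budget `r₁ K + (e^{2l₀B} − 1)ρ K ≤ vol·δ K` ⇒ `Spine.NE7.Core l₀ vol T Bad P Q δ` for EVERY `B`-bounded class-space MGF-form
  observable family — ONE application of `core_of_tiltPath` to `(Λ, h)`), ★ `tiltedMeanMatching_of_finePath` (CONDITIONED OSC alone ⇒ N14's
  binder with `η K = 4B·e^{2l₀B}·ρ K` on the image pieces).
* §4 THE SAME WITH THE OSC LETTER KERNEL-FREE (`condOsc_kernel_of_condExp`, by the dictionary's `condDirection_comp_ae_eq_condExp`):
  ★★ `core_of_finePath_condExp`, ★ `tiltedMeanMatching_of_finePath_condExp` — hypothesis `∫ |ν̂_u[Ψ′_u | σ(q K)] − ν̂_u[Ψ′_u]| dν̂_u ≤ 2ρ K`,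
  `ν̂_u = (νA K τ).tilted (Ψ K τ u)`: the (F2″) letter of file P p499366 §3 ∕ 31-I p517989 ∕ 34 p525061, class by class.
READING.  The N14 law channel's CURRENCY (F2″) — first moment of the direction under the interpolating fine laws + L¹-oscillation of its
conditional expectation on the class field — PRODUCES N19's class-level statement `Core` (and MASS_cl ∕ TV_cl) BY NAME, not only N14's binder;
the raw fine-space oscillation never enters.  OBJECT-bound, unchanged: the fine pieces, the path (straight one-step log-density, or CARD 11's
tuned path `…N14LawChannelTunedPath.exists_tuned_path` p520761) and the numbers `r₁ K`, `ρ K`, `Σ δ K < ∞` — NODE O's ∕ NE5–NE7's, produced by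
nobody.
HONEST FRAMING.  [folklore] measure theory on hypothesis SHAPES (the dictionary ∘ road III); SUPPORT-MATCHED case only (tilt paths force
`νA ~ νB`); NE1′ ∕ NE7 NOT PRINTED as two-run statements for d = 4, NOT proved; N14 ∕ N19 NOT discharged; K3⁶ NOT claimed; counts UNMOVED
(typed 28∕28 · discharged 5∕27 · A 5∕28); one finite four-torus at fixed `ε` — NOT ℝ⁴, NOT OS, NOT a mass gap, NOT Clay.  0 `def`; 0 `sorry`;
standard axioms.
-/

set_option autoImplicit false

noncomputable section

open MeasureTheory ProbabilityTheory Set Filter Topology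
open scoped ENNReal NNReal

namespace YMDAG.N14.LawChannelPushForwardRoad

open Literature.MathematicalPhysics.QuantumFieldTheory.Balaban1983to89.T4AveragingDisintegration (condLaw)
open Summit.QuantumFields.BalabanUV.T4Continuum.NE1p.DressedMGFForm (tiltedMean MGFForm TiltedMeanMatching)
open Summit.QuantumFields.BalabanUV.T4Continuum.Spine.NE7 (Core)
open Summit.QuantumFields.YangMills.BalabanUVNodes.N19TiltPathRoad (massSandwich_of_tiltPath tvSandwich_of_tiltPath core_of_tiltPath
  tiltedMeanMatching_of_tiltPath)
open YMDAG.N14.LawChannelPushForward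
open YMDAG.N14.LawChannelPushForwardPath

/-! ## §3 The junction: fine DRIFT + CONDITIONED OSC ⇒ MASS_cl, TV_cl, `Core`, N14's binder on the image pieces (kernel letters) -/

section Junction

variable {ι : Type*} [DecidableEq ι] {Φ Ω : ℕ → Type*} [∀ K, MeasurableSpace (Φ K)] [∀ K, StandardBorelSpace (Φ K)]
  [∀ K, Nonempty (Φ K)] [∀ K, MeasurableSpace (Ω K)]
  {q : ∀ K, Φ K → Ω K} {νA νB : ∀ K, ι → Measure (Φ K)} [∀ K τ, IsFiniteMeasure (νA K τ)]
  {l₀ vol B : ℝ} {T : ℕ → Finset ι} {Bad : ℕ → ℝ → Finset ι} {W : ∀ K, Ω K → ℝ}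
  {P Q : ℕ → ℝ → ι → ℝ} {δ r₁ ρ : ℕ → ℝ}
  {Ψ Ψ' : ∀ K, ι → ℝ → Φ K → ℝ} {Λ h : ∀ K, ι → ℝ → Ω K → ℝ} {k k' : ℕ → ℝ → ℝ}

omit [∀ K, StandardBorelSpace (Φ K)] [∀ K, Nonempty (Φ K)] [∀ K τ, IsFiniteMeasure (νA K τ)] [DecidableEq ι] in
/-- **MGF FORM FOR A FIBRE-BLIND OBSERVABLE IS MGF FORM ON THE IMAGE LAWS** (lens (OBS)): dressed terms `A K t τ = ∫ e^{t·(W K ∘ q K)} dν K τ` in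
MGF form on the fine pieces are in MGF form `∫ e^{t·W K} d((ν K τ).map (q K))` on the image pieces. [folklore] -/
theorem mgfForm_map_of_comp {ν : ∀ K, ι → Measure (Φ K)} {A : ℕ → ℝ → ι → ℝ} (hq : ∀ K, Measurable (q K))
    (hA : MGFForm B T (fun K => W K ∘ q K) ν A) (hWm : ∀ K, Measurable (W K)) (hWb : ∀ K ω, |W K ω| ≤ B) :
    MGFForm B T W (fun K τ => (ν K τ).map (q K)) A where
  nonneg := hA.nonneg
  meas := hWm
  bound := hWb
  finite := fun K τ hτ => by haveI := hA.finite K τ hτ; infer_instance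
  repr := fun K t τ hτ => by
    rw [hA.repr K t τ hτ, mgf, mgf, integral_map (hq K).aemeasurable]
    · rfl
    · exact (Real.measurable_exp.comp (measurable_const.mul (hWm K))).aestronglyMeasurable

omit [DecidableEq ι] in
/-- The bundle of road III's class-space hypotheses produced from the fine data (used by the four junction theorems). [folklore] -/
theorem classPath_letters (hq : ∀ K, Measurable (q K))
    (hΨm : ∀ K τ u, Measurable (Ψ K τ u)) (hΨ'm : ∀ K τ u, Measurable (Ψ' K τ u))
    (hΨd : ∀ K τ u x, HasDerivAt (fun v => Ψ K τ v x) (Ψ' K τ u x) u)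
    (hbd : ∀ K τ (u₀ : ℝ), ∃ ε > 0, ∃ M : ℝ, ∀ u ∈ Metric.ball u₀ ε, ∀ x, |Ψ K τ u x| ≤ M ∧ |Ψ' K τ u x| ≤ M)
    (hΨ0 : ∀ K τ x, Ψ K τ 0 x = 0)
    (hB : ∀ K, ∀ τ ∈ T K, νB K τ = (νA K τ).withDensity fun x => ENNReal.ofReal (Real.exp (Ψ K τ 1 x)))
    (hΛ : ∀ K τ u V, Λ K τ u V = Real.log (∫ U, Real.exp (Ψ K τ u U) ∂(condLaw (νA K τ) (q K) V)))
    (hh : ∀ K τ u V, h K τ u V = ∫ U, Ψ' K τ u U ∂((condLaw (νA K τ) (q K) V).tilted (Ψ K τ u))) :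
    (∀ K, ∀ τ ∈ T K, IsFiniteMeasure ((νA K τ).map (q K))) ∧
    (∀ K τ u, Measurable (Λ K τ u)) ∧ (∀ K τ u, Measurable (h K τ u)) ∧
    (∀ K τ u V, HasDerivAt (fun v => Λ K τ v V) (h K τ u V) u) ∧
    (∀ K τ (u₀ : ℝ), ∃ ε > 0, ∃ M : ℝ, ∀ u ∈ Metric.ball u₀ ε, ∀ V, |Λ K τ u V| ≤ M ∧ |h K τ u V| ≤ M) ∧
    (∀ K τ V, Λ K τ 0 V = 0) ∧
    (∀ K, ∀ τ ∈ T K, (νB K τ).map (q K) =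
      ((νA K τ).map (q K)).withDensity fun V => ENNReal.ofReal (Real.exp (Λ K τ 1 V))) :=
  ⟨fun K τ _ => inferInstance,
   fun K τ u => measurable_classPath (νA K τ) (hΨm K τ) (hΛ K τ) u,
   fun K τ u => measurable_classDir (νA K τ) (hΨm K τ) (hΨ'm K τ) (hh K τ) u,
   fun K τ u V => hasDerivAt_classPath (νA K τ) (hΨm K τ) (hΨ'm K τ) (hΨd K τ) (hbd K τ) (hΛ K τ) (hh K τ) u V,
   fun K τ u₀ => classPath_bounds (νA K τ) (hΨm K τ) (hbd K τ) (hΛ K τ) (hh K τ) u₀,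
   fun K τ V => classPath_zero (νA K τ) (hΨ0 K τ) (hΛ K τ) V,
   fun K τ hτ => by rw [hB K τ hτ]; exact map_withDensity_exp_classPath (νA K τ) (hq K) (hΨm K τ) (hbd K τ) (hΛ K τ)⟩

/-- ★ **MASS_cl ON THE IMAGE PIECES FROM THE FINE DRIFT.**  If on every (t-uniformly) good non-null class the tilted mean of the fine path
direction under the interpolating FINE law `ν̂_{K,τ,u} = (νA K τ).tilted (Ψ K τ u)` stays within `r₁ K` of ONE class-free drift `k′_K(u)` on
`[0,1]`, then the image pieces satisfy MASS_cl(r₁) in road III's `ℝ≥0∞` letters with `c_K = k_K 1 − k_K 0` — the drift is INVARIANT under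
push-forward (`integral_classDir_eq`), so road III's `massSandwich_of_tiltPath` applies to `(Λ, h)` verbatim. [folklore] -/
theorem massSandwich_of_finePath (hq : ∀ K, Measurable (q K))
    (hΨm : ∀ K τ u, Measurable (Ψ K τ u)) (hΨ'm : ∀ K τ u, Measurable (Ψ' K τ u))
    (hΨd : ∀ K τ u x, HasDerivAt (fun v => Ψ K τ v x) (Ψ' K τ u x) u)
    (hbd : ∀ K τ (u₀ : ℝ), ∃ ε > 0, ∃ M : ℝ, ∀ u ∈ Metric.ball u₀ ε, ∀ x, |Ψ K τ u x| ≤ M ∧ |Ψ' K τ u x| ≤ M)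
    (hΨ0 : ∀ K τ x, Ψ K τ 0 x = 0)
    (hB : ∀ K, ∀ τ ∈ T K, νB K τ = (νA K τ).withDensity fun x => ENNReal.ofReal (Real.exp (Ψ K τ 1 x)))
    (hΛ : ∀ K τ u V, Λ K τ u V = Real.log (∫ U, Real.exp (Ψ K τ u U) ∂(condLaw (νA K τ) (q K) V)))
    (hh : ∀ K τ u V, h K τ u V = ∫ U, Ψ' K τ u U ∂((condLaw (νA K τ) (q K) V).tilted (Ψ K τ u)))
    (hk : ∀ K, ∀ u ∈ Icc (0 : ℝ) 1, HasDerivWithinAt (k K) (k' K u) (Icc (0 : ℝ) 1) u)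
    (hdrift : ∀ (K : ℕ) (t : ℝ), |t| ≤ l₀ → ∀ τ ∈ T K \ Bad K t, νA K τ ≠ 0 → ∀ u ∈ Icc (0 : ℝ) 1,
      |∫ x, Ψ' K τ u x ∂((νA K τ).tilted (Ψ K τ u)) - k' K u| ≤ r₁ K) :
    ∀ K : ℕ, ∃ c : ℝ, ∀ t : ℝ, |t| ≤ l₀ → ∀ τ ∈ T K \ Bad K t,
      ENNReal.ofReal (Real.exp (c - r₁ K)) * (νA K τ).map (q K) Set.univ ≤ (νB K τ).map (q K) Set.univ ∧
        (νB K τ).map (q K) Set.univ ≤ ENNReal.ofReal (Real.exp (c + r₁ K)) * (νA K τ).map (q K) Set.univ := by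
  obtain ⟨hfin, hΛm, hhm, hΛd, hΛbd, hΛ0, hBc⟩ := classPath_letters hq hΨm hΨ'm hΨd hbd hΨ0 hB hΛ hh
  refine massSandwich_of_tiltPath (μA := fun K τ => (νA K τ).map (q K)) (μB := fun K τ => (νB K τ).map (q K))
    hfin hΛm hhm hΛd hΛbd hΛ0 hBc hk fun K t ht τ hτ h0 u hu => ?_
  rw [integral_classDir_eq (νA K τ) (hq K) (hΨm K τ) (hΨ'm K τ) (hbd K τ) (hΛ K τ) (hh K τ) u]
  exact hdrift K t ht τ hτ ((Measure.map_ne_zero_iff (hq K).aemeasurable).1 h0) u hu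

/-- ★ **TV_cl ON THE IMAGE PIECES FROM THE CONDITIONED OSCILLATION.**  If on every good non-null class the fine-space L¹-oscillation of
the CONDITIONED direction `h_{K,τ,u} ∘ q K` (`h_u(V) = ∫ Ψ′_u d((condLaw νA q V).tilted Ψ_u)`) about the fine drift, under the interpolating
fine law, is `≤ 2ρ K` on `[0,1]`, then the NORMALISED image laws of the two runs are `ρ K`-close on every measurable class-space set —
road III's `tvSandwich_of_tiltPath` on `(Λ, h)`; the RAW fine oscillation is never used. [folklore] -/
theorem tvSandwich_of_finePath (hq : ∀ K, Measurable (q K))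
    (hΨm : ∀ K τ u, Measurable (Ψ K τ u)) (hΨ'm : ∀ K τ u, Measurable (Ψ' K τ u))
    (hΨd : ∀ K τ u x, HasDerivAt (fun v => Ψ K τ v x) (Ψ' K τ u x) u)
    (hbd : ∀ K τ (u₀ : ℝ), ∃ ε > 0, ∃ M : ℝ, ∀ u ∈ Metric.ball u₀ ε, ∀ x, |Ψ K τ u x| ≤ M ∧ |Ψ' K τ u x| ≤ M)
    (hΨ0 : ∀ K τ x, Ψ K τ 0 x = 0)
    (hB : ∀ K, ∀ τ ∈ T K, νB K τ = (νA K τ).withDensity fun x => ENNReal.ofReal (Real.exp (Ψ K τ 1 x))) (hρ : ∀ K, 0 ≤ ρ K)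
    (hΛ : ∀ K τ u V, Λ K τ u V = Real.log (∫ U, Real.exp (Ψ K τ u U) ∂(condLaw (νA K τ) (q K) V)))
    (hh : ∀ K τ u V, h K τ u V = ∫ U, Ψ' K τ u U ∂((condLaw (νA K τ) (q K) V).tilted (Ψ K τ u)))
    (hosc : ∀ (K : ℕ) (t : ℝ), |t| ≤ l₀ → ∀ τ ∈ T K \ Bad K t, νA K τ ≠ 0 → ∀ u ∈ Icc (0 : ℝ) 1,
      ∫ x, |h K τ u (q K x) - ∫ y, Ψ' K τ u y ∂((νA K τ).tilted (Ψ K τ u))| ∂((νA K τ).tilted (Ψ K τ u)) ≤ 2 * ρ K) :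
    ∀ (K : ℕ) (t : ℝ), |t| ≤ l₀ → ∀ τ ∈ T K \ Bad K t, ∀ S : Set (Ω K), MeasurableSet S →
      |((νB K τ).map (q K)).real S / ((νB K τ).map (q K)).real Set.univ -
        ((νA K τ).map (q K)).real S / ((νA K τ).map (q K)).real Set.univ| ≤ ρ K := by
  obtain ⟨hfin, hΛm, hhm, hΛd, hΛbd, hΛ0, hBc⟩ := classPath_letters hq hΨm hΨ'm hΨd hbd hΨ0 hB hΛ hh
  refine tvSandwich_of_tiltPath (μA := fun K τ => (νA K τ).map (q K)) (μB := fun K τ => (νB K τ).map (q K))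
    hfin hΛm hhm hΛd hΛbd hΛ0 hBc hρ fun K t ht τ hτ h0 u hu => ?_
  show ∫ V, |h K τ u V - ∫ V', h K τ u V' ∂((νA K τ).map (q K)).tilted (Λ K τ u)| ∂((νA K τ).map (q K)).tilted (Λ K τ u) ≤ 2 * ρ K
  rw [integral_classDir_eq (νA K τ) (hq K) (hΨm K τ) (hΨ'm K τ) (hbd K τ) (hΛ K τ) (hh K τ) u,
    integral_abs_classDir_sub_eq (νA K τ) (hq K) (hΨm K τ) (hΨ'm K τ) (hbd K τ) (hΛ K τ) (hh K τ) u]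
  exact hosc K t ht τ hτ ((Measure.map_ne_zero_iff (hq K).aemeasurable).1 h0) u hu

/-- ★★ **THE LAW CHANNEL PRODUCES `Spine.NE7.Core` BY NAME.**  Two runs' dressed class terms in MGF form on the IMAGE pieces for ONE `B`-bounded
class-space observable family; fine class pieces joined by a fine tilt path; on the good non-null classes (i) the FINE drift within `r₁ K` of a
class-free `k′_K` and (ii) the CONDITIONED oscillation `≤ 2ρ K`; width budget `r₁ K + (e^{2l₀B} − 1)·ρ K ≤ vol·δ K`.  Then
`Core l₀ vol T Bad P Q δ` — ONE application of road III's `core_of_tiltPath` to the pushed-forward path `(Λ, h)`. [folklore] -/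
theorem core_of_finePath (hq : ∀ K, Measurable (q K))
    (hP : MGFForm B T W (fun K τ => (νA K τ).map (q K)) P) (hQ : MGFForm B T W (fun K τ => (νB K τ).map (q K)) Q)
    (hΨm : ∀ K τ u, Measurable (Ψ K τ u)) (hΨ'm : ∀ K τ u, Measurable (Ψ' K τ u))
    (hΨd : ∀ K τ u x, HasDerivAt (fun v => Ψ K τ v x) (Ψ' K τ u x) u)
    (hbd : ∀ K τ (u₀ : ℝ), ∃ ε > 0, ∃ M : ℝ, ∀ u ∈ Metric.ball u₀ ε, ∀ x, |Ψ K τ u x| ≤ M ∧ |Ψ' K τ u x| ≤ M)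
    (hΨ0 : ∀ K τ x, Ψ K τ 0 x = 0)
    (hB : ∀ K, ∀ τ ∈ T K, νB K τ = (νA K τ).withDensity fun x => ENNReal.ofReal (Real.exp (Ψ K τ 1 x))) (hρ : ∀ K, 0 ≤ ρ K)
    (hΛ : ∀ K τ u V, Λ K τ u V = Real.log (∫ U, Real.exp (Ψ K τ u U) ∂(condLaw (νA K τ) (q K) V)))
    (hh : ∀ K τ u V, h K τ u V = ∫ U, Ψ' K τ u U ∂((condLaw (νA K τ) (q K) V).tilted (Ψ K τ u)))
    (hk : ∀ K, ∀ u ∈ Icc (0 : ℝ) 1, HasDerivWithinAt (k K) (k' K u) (Icc (0 : ℝ) 1) u)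
    (hdrift : ∀ (K : ℕ) (t : ℝ), |t| ≤ l₀ → ∀ τ ∈ T K \ Bad K t, νA K τ ≠ 0 → ∀ u ∈ Icc (0 : ℝ) 1,
      |∫ x, Ψ' K τ u x ∂((νA K τ).tilted (Ψ K τ u)) - k' K u| ≤ r₁ K)
    (hosc : ∀ (K : ℕ) (t : ℝ), |t| ≤ l₀ → ∀ τ ∈ T K \ Bad K t, νA K τ ≠ 0 → ∀ u ∈ Icc (0 : ℝ) 1,
      ∫ x, |h K τ u (q K x) - ∫ y, Ψ' K τ u y ∂((νA K τ).tilted (Ψ K τ u))| ∂((νA K τ).tilted (Ψ K τ u)) ≤ 2 * ρ K)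
    (hw : ∀ K, r₁ K + (Real.exp (2 * (l₀ * B)) - 1) * ρ K ≤ vol * δ K) :
    Core l₀ vol T Bad P Q δ := by
  obtain ⟨-, hΛm, hhm, hΛd, hΛbd, hΛ0, hBc⟩ := classPath_letters hq hΨm hΨ'm hΨd hbd hΨ0 hB hΛ hh
  refine core_of_tiltPath hP hQ hΛm hhm hΛd hΛbd hΛ0 hBc hρ hk (fun K t ht τ hτ h0 u hu => ?_) (fun K t ht τ hτ h0 u hu => ?_) hw
  · rw [integral_classDir_eq (νA K τ) (hq K) (hΨm K τ) (hΨ'm K τ) (hbd K τ) (hΛ K τ) (hh K τ) u]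
    exact hdrift K t ht τ hτ ((Measure.map_ne_zero_iff (hq K).aemeasurable).1 h0) u hu
  · show ∫ V, |h K τ u V - ∫ V', h K τ u V' ∂((νA K τ).map (q K)).tilted (Λ K τ u)| ∂((νA K τ).map (q K)).tilted (Λ K τ u) ≤ 2 * ρ K
    rw [integral_classDir_eq (νA K τ) (hq K) (hΨm K τ) (hΨ'm K τ) (hbd K τ) (hΛ K τ) (hh K τ) u,
      integral_abs_classDir_sub_eq (νA K τ) (hq K) (hΨm K τ) (hΨ'm K τ) (hbd K τ) (hΛ K τ) (hh K τ) u]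
    exact hosc K t ht τ hτ ((Measure.map_ne_zero_iff (hq K).aemeasurable).1 h0) u hu

/-- ★ **… AND N14's BINDER**: the conditioned oscillation alone gives `TiltedMeanMatching l₀ T Bad W μA W μB (K ↦ 4B·e^{2l₀B}·ρ K)` on the image
pieces `μX K τ = (νX K τ).map (q K)` for every `B`-bounded measurable class-space observable family (road III :172 on `(Λ, h)`). [folklore] -/
theorem tiltedMeanMatching_of_finePath (hq : ∀ K, Measurable (q K)) (hB0 : 0 ≤ B)
    (hWm : ∀ K, Measurable (W K)) (hWb : ∀ K ω, |W K ω| ≤ B)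
    (hΨm : ∀ K τ u, Measurable (Ψ K τ u)) (hΨ'm : ∀ K τ u, Measurable (Ψ' K τ u))
    (hΨd : ∀ K τ u x, HasDerivAt (fun v => Ψ K τ v x) (Ψ' K τ u x) u)
    (hbd : ∀ K τ (u₀ : ℝ), ∃ ε > 0, ∃ M : ℝ, ∀ u ∈ Metric.ball u₀ ε, ∀ x, |Ψ K τ u x| ≤ M ∧ |Ψ' K τ u x| ≤ M)
    (hΨ0 : ∀ K τ x, Ψ K τ 0 x = 0)
    (hB : ∀ K, ∀ τ ∈ T K, νB K τ = (νA K τ).withDensity fun x => ENNReal.ofReal (Real.exp (Ψ K τ 1 x))) (hρ : ∀ K, 0 ≤ ρ K)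
    (hΛ : ∀ K τ u V, Λ K τ u V = Real.log (∫ U, Real.exp (Ψ K τ u U) ∂(condLaw (νA K τ) (q K) V)))
    (hh : ∀ K τ u V, h K τ u V = ∫ U, Ψ' K τ u U ∂((condLaw (νA K τ) (q K) V).tilted (Ψ K τ u)))
    (hosc : ∀ (K : ℕ) (t : ℝ), |t| ≤ l₀ → ∀ τ ∈ T K \ Bad K t, νA K τ ≠ 0 → ∀ u ∈ Icc (0 : ℝ) 1,
      ∫ x, |h K τ u (q K x) - ∫ y, Ψ' K τ u y ∂((νA K τ).tilted (Ψ K τ u))| ∂((νA K τ).tilted (Ψ K τ u)) ≤ 2 * ρ K) :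
    TiltedMeanMatching l₀ T Bad W (fun K τ => (νA K τ).map (q K)) W (fun K τ => (νB K τ).map (q K))
      fun K => 4 * B * Real.exp (2 * (l₀ * B)) * ρ K := by
  obtain ⟨hfin, hΛm, hhm, hΛd, hΛbd, hΛ0, hBc⟩ := classPath_letters (T := T) hq hΨm hΨ'm hΨd hbd hΨ0 hB hΛ hh
  refine tiltedMeanMatching_of_tiltPath hfin hB0 hWm hWb hΛm hhm hΛd hΛbd hΛ0 hBc hρ fun K t ht τ hτ h0 u hu => ?_
  show ∫ V, |h K τ u V - ∫ V', h K τ u V' ∂((νA K τ).map (q K)).tilted (Λ K τ u)| ∂((νA K τ).map (q K)).tilted (Λ K τ u) ≤ 2 * ρ K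
  rw [integral_classDir_eq (νA K τ) (hq K) (hΨm K τ) (hΨ'm K τ) (hbd K τ) (hΛ K τ) (hh K τ) u,
    integral_abs_classDir_sub_eq (νA K τ) (hq K) (hΨm K τ) (hΨ'm K τ) (hbd K τ) (hΛ K τ) (hh K τ) u]
  exact hosc K t ht τ hτ ((Measure.map_ne_zero_iff (hq K).aemeasurable).1 h0) u hu

end Junction

/-! ## §4 The same with the OSC letter in the law channel's kernel-free condExp form -/

section CondExp

variable {ι : Type*} [DecidableEq ι] {Φ Ω : ℕ → Type*} [∀ K, MeasurableSpace (Φ K)] [∀ K, StandardBorelSpace (Φ K)]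
  [∀ K, Nonempty (Φ K)] [∀ K, MeasurableSpace (Ω K)]
  {q : ∀ K, Φ K → Ω K} {νA νB : ∀ K, ι → Measure (Φ K)} [∀ K τ, IsFiniteMeasure (νA K τ)]
  {l₀ vol B : ℝ} {T : ℕ → Finset ι} {Bad : ℕ → ℝ → Finset ι} {W : ∀ K, Ω K → ℝ}
  {P Q : ℕ → ℝ → ι → ℝ} {δ r₁ ρ : ℕ → ℝ}
  {Ψ Ψ' : ∀ K, ι → ℝ → Φ K → ℝ} {k k' : ℕ → ℝ → ℝ}

omit [DecidableEq ι] in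
/-- From the condExp letter to the kernel letter: on a non-null piece the fine-space L¹-oscillation of `ν̂[Ψ′ | σ(q)]` IS that of the
conditioned direction `h ∘ q` (the dictionary's `condDirection_comp_ae_eq_condExp`). [folklore] -/
theorem condOsc_kernel_of_condExp {K : ℕ} {τ : ι} (hq : Measurable (q K))
    (hΨm : ∀ u, Measurable (Ψ K τ u)) (hΨ'm : ∀ u, Measurable (Ψ' K τ u))
    (hbd : ∀ u₀ : ℝ, ∃ ε > 0, ∃ M : ℝ, ∀ u ∈ Metric.ball u₀ ε, ∀ x, |Ψ K τ u x| ≤ M ∧ |Ψ' K τ u x| ≤ M)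
    (h0 : νA K τ ≠ 0) (u c : ℝ) :
    ∫ x, |(∫ U, Ψ' K τ u U ∂((condLaw (νA K τ) (q K) (q K x)).tilted (Ψ K τ u))) - c| ∂((νA K τ).tilted (Ψ K τ u)) =
      ∫ x, |((νA K τ).tilted (Ψ K τ u))[Ψ' K τ u | MeasurableSpace.comap (q K) inferInstance] x - c|
        ∂((νA K τ).tilted (Ψ K τ u)) := by
  haveI : NeZero (νA K τ) := ⟨h0⟩
  obtain ⟨M, hM, hM'⟩ := exists_bound_at (hbd := hbd) u
  have hae := condDirection_comp_ae_eq_condExp (νA K τ) hq (hΨm u) hM (hΨ'm u) hM'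
    (h := fun V => ∫ U, Ψ' K τ u U ∂((condLaw (νA K τ) (q K) V).tilted (Ψ K τ u))) (fun _ => rfl)
  refine integral_congr_ae ?_
  filter_upwards [hae] with x hx
  rw [← hx]
  rfl

/-- ★★ **`Core` FROM THE LAW CHANNEL's LETTERS, condExp form**: as `core_of_finePath`, with the oscillation hypothesis stated kernel-free —
`∫ |ν̂_{K,τ,u}[Ψ′_{K,τ,u} | σ(q K)] − ν̂_{K,τ,u}[Ψ′_{K,τ,u}]| dν̂_{K,τ,u} ≤ 2ρ K` on the good non-null classes, `ν̂ = (νA K τ).tilted (Ψ K τ u)` —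
the (F2″) letter of file P §3 ∕ 31-I, class by class. [folklore] -/
theorem core_of_finePath_condExp (hq : ∀ K, Measurable (q K))
    (hP : MGFForm B T W (fun K τ => (νA K τ).map (q K)) P) (hQ : MGFForm B T W (fun K τ => (νB K τ).map (q K)) Q)
    (hΨm : ∀ K τ u, Measurable (Ψ K τ u)) (hΨ'm : ∀ K τ u, Measurable (Ψ' K τ u))
    (hΨd : ∀ K τ u x, HasDerivAt (fun v => Ψ K τ v x) (Ψ' K τ u x) u)
    (hbd : ∀ K τ (u₀ : ℝ), ∃ ε > 0, ∃ M : ℝ, ∀ u ∈ Metric.ball u₀ ε, ∀ x, |Ψ K τ u x| ≤ M ∧ |Ψ' K τ u x| ≤ M)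
    (hΨ0 : ∀ K τ x, Ψ K τ 0 x = 0)
    (hB : ∀ K, ∀ τ ∈ T K, νB K τ = (νA K τ).withDensity fun x => ENNReal.ofReal (Real.exp (Ψ K τ 1 x))) (hρ : ∀ K, 0 ≤ ρ K)
    (hk : ∀ K, ∀ u ∈ Icc (0 : ℝ) 1, HasDerivWithinAt (k K) (k' K u) (Icc (0 : ℝ) 1) u)
    (hdrift : ∀ (K : ℕ) (t : ℝ), |t| ≤ l₀ → ∀ τ ∈ T K \ Bad K t, νA K τ ≠ 0 → ∀ u ∈ Icc (0 : ℝ) 1,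
      |∫ x, Ψ' K τ u x ∂((νA K τ).tilted (Ψ K τ u)) - k' K u| ≤ r₁ K)
    (hosc : ∀ (K : ℕ) (t : ℝ), |t| ≤ l₀ → ∀ τ ∈ T K \ Bad K t, νA K τ ≠ 0 → ∀ u ∈ Icc (0 : ℝ) 1,
      ∫ x, |((νA K τ).tilted (Ψ K τ u))[Ψ' K τ u | MeasurableSpace.comap (q K) inferInstance] x -
        ∫ y, Ψ' K τ u y ∂((νA K τ).tilted (Ψ K τ u))| ∂((νA K τ).tilted (Ψ K τ u)) ≤ 2 * ρ K)
    (hw : ∀ K, r₁ K + (Real.exp (2 * (l₀ * B)) - 1) * ρ K ≤ vol * δ K) :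
    Core l₀ vol T Bad P Q δ :=
  core_of_finePath (Λ := fun K τ u V => Real.log (∫ U, Real.exp (Ψ K τ u U) ∂(condLaw (νA K τ) (q K) V)))
    (h := fun K τ u V => ∫ U, Ψ' K τ u U ∂((condLaw (νA K τ) (q K) V).tilted (Ψ K τ u)))
    hq hP hQ hΨm hΨ'm hΨd hbd hΨ0 hB hρ (fun _ _ _ _ => rfl) (fun _ _ _ _ => rfl) hk hdrift
    (fun K t ht τ hτ h0 u hu => by
      rw [condOsc_kernel_of_condExp (νA := νA) (hq K) (hΨm K τ) (hΨ'm K τ) (hbd K τ) h0]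
      exact hosc K t ht τ hτ h0 u hu) hw

/-- ★ **N14's BINDER FROM THE LAW CHANNEL's LETTERS, condExp form**: as `tiltedMeanMatching_of_finePath`, oscillation hypothesis kernel-free.
[folklore] -/
theorem tiltedMeanMatching_of_finePath_condExp (hq : ∀ K, Measurable (q K)) (hB0 : 0 ≤ B)
    (hWm : ∀ K, Measurable (W K)) (hWb : ∀ K ω, |W K ω| ≤ B)
    (hΨm : ∀ K τ u, Measurable (Ψ K τ u)) (hΨ'm : ∀ K τ u, Measurable (Ψ' K τ u))
    (hΨd : ∀ K τ u x, HasDerivAt (fun v => Ψ K τ v x) (Ψ' K τ u x) u)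
    (hbd : ∀ K τ (u₀ : ℝ), ∃ ε > 0, ∃ M : ℝ, ∀ u ∈ Metric.ball u₀ ε, ∀ x, |Ψ K τ u x| ≤ M ∧ |Ψ' K τ u x| ≤ M)
    (hΨ0 : ∀ K τ x, Ψ K τ 0 x = 0)
    (hB : ∀ K, ∀ τ ∈ T K, νB K τ = (νA K τ).withDensity fun x => ENNReal.ofReal (Real.exp (Ψ K τ 1 x))) (hρ : ∀ K, 0 ≤ ρ K)
    (hosc : ∀ (K : ℕ) (t : ℝ), |t| ≤ l₀ → ∀ τ ∈ T K \ Bad K t, νA K τ ≠ 0 → ∀ u ∈ Icc (0 : ℝ) 1,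
      ∫ x, |((νA K τ).tilted (Ψ K τ u))[Ψ' K τ u | MeasurableSpace.comap (q K) inferInstance] x -
        ∫ y, Ψ' K τ u y ∂((νA K τ).tilted (Ψ K τ u))| ∂((νA K τ).tilted (Ψ K τ u)) ≤ 2 * ρ K) :
    TiltedMeanMatching l₀ T Bad W (fun K τ => (νA K τ).map (q K)) W (fun K τ => (νB K τ).map (q K))
      fun K => 4 * B * Real.exp (2 * (l₀ * B)) * ρ K :=
  tiltedMeanMatching_of_finePath (Λ := fun K τ u V => Real.log (∫ U, Real.exp (Ψ K τ u U) ∂(condLaw (νA K τ) (q K) V)))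
    (h := fun K τ u V => ∫ U, Ψ' K τ u U ∂((condLaw (νA K τ) (q K) V).tilted (Ψ K τ u)))
    hq hB0 hWm hWb hΨm hΨ'm hΨd hbd hΨ0 hB hρ (fun _ _ _ _ => rfl) (fun _ _ _ _ => rfl)
    (fun K t ht τ hτ h0 u hu => by
      rw [condOsc_kernel_of_condExp (νA := νA) (hq K) (hΨm K τ) (hΨ'm K τ) (hbd K τ) h0]
      exact hosc K t ht τ hτ h0 u hu)

end CondExp


end YMDAG.N14.LawChannelPushForwardRoad

end
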